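import Mathlib
import HarnessLib
import Literature.Analysis.FluidPDE.ClassicalSolution
import Literature.Analysis.FluidPDE.LerayHopf
import Literature.Analysis.FluidPDE.SuitableWeak
import Literature.Analysis.FluidPDE.EnstrophySplitting
import Literature.Analysis.FluidPDE.NSHopfLimit
import Summits.NavierStokesRegularity.NavierStokesRegularity.Theses.QuarterJolt
import Summits.NavierStokesRegularity.NavierStokesRegularity.Theorems.QuarterJoltNoTerminalJoltRegularTime
import Summits.NavierStokesRegularity.NavierStokesRegularity.Theorems.QuarterJoltEnergyJumpLaw
import Summits.NavierStokesRegularity.NavierStokesRegularity.Theorems.QuarterJoltTypeIEnergyEqualityPosition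
import Summits.NavierStokesRegularity.NavierStokesRegularity.Theorems.QuarterJoltEnstrophyRateEnergyEquality

/-!
# Route QuarterJolt — crux `NoTerminalJolt` (stmt-NavierStokesRegularity-26463), LEAD line
# `regular_split` rev 5: NO ENERGY ATOM at Type-I / enstrophy-mild first blow-ups; typed edge to
# WeakLambdaEndpoint's `stub_noEnergyAtom` (crux stmt-19625)

Seat ns-ntj-p1 g4 (LEAD of the crux; `--supports 26463 --as helper`). An ENERGY ATOM at time `T` at
`x₀` means `limsup_{t↑T} ∫_{B(x₀,r)}|u(t)|² ≥ η > 0` for every `r` (Leslie–Shvydkoy 2018, Question 1.1 /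
§1.3; the stub `stub_noEnergyAtom` of `Cruxes/WeakLambdaCriterion/Lines/birth.lean`, route
WeakLambdaEndpoint, crux stmt-NavierStokesRegularity-19625, asks for NO atom at any frame time and
notes «known under Type I in time»). Strong `L²`-continuity into `T` forbids atoms
(`∫_B|u(t)|² ≤ 2∫|u(t)−u(T)|² + 2∫_B|u(T)|²`, absolute continuity of `|u(T)|²dx`), so the g4 energy
equalities give:

* `exists_ball_forall_eventually_lt_of_tendsto_eLpNorm_sub` (frame-free), `noEnergyAtom_of_tendsto_eLpNorm_sub`;
* `noEnergyAtom_of_isTypeIBlowup` — Type-I rate at `T` ⇒ no energy atom at `T` (p639359);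
* `noEnergyAtom_of_enstrophyRate` — `∫|Du(t)|²_F ≤ M(T−t)^{−α}`, `α < 4/5` ⇒ no energy atom (p641804);
* `noEnergyAtom_of_energyEqualityAtBlowup`, `noEnergyAtom_of_typeIIEnergyEquality` — STUB 3 of
  `regular_split` (crux 26463) ⇒ STUB 2 of WeakLambdaCriterion's `birth` (crux 19625), statements
  verbatim; `noEnergyAtom_of_noTerminalJolt` — the crux BY NAME ⇒ that stub.

HONEST FRAMING: typed edges and Type-I / enstrophy-mild cases only; `stub_noEnergyAtom`,
`stub_typeIIEnergyEquality`, `NoTerminalJolt`, `WeakLambdaCriterion` and Navier–Stokes regularity are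
OPEN; nothing here claims progress on them. No summit statement is proved here. [folklore]
-/

noncomputable section

-- the summit and its single sub-problem share the name (CONVENTIONS §1), as in every Theorems file
set_option linter.dupNamespace false

namespace Summit.NavierStokesRegularity.NavierStokesRegularity.Theorems

open MeasureTheory Set Function Filter Topology InnerProductSpace
open scoped ENNReal NNReal
open Literature.Analysis.FluidPDE

namespace NoTerminalJolt

/-! ### Strong `L²`-continuity into `T` leaves no energy atom -/

/-- **Strong `L²`-continuity into `T` leaves NO ENERGY ATOM at `T`** (frame-free). If the slices `u t`
are a.e.-strongly measurable for `t < T` near `T`, `u T ∈ L²`, and `‖u(t) − u(T)‖_{L²} → 0` as `t ↑ T`,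
then for every centre `x₀` and every `η > 0` there is `r > 0` with `∫_{B(x₀,r)} ‖u(t)‖² < η` for all
`t < T` near `T` (`∫_B|u(t)|² ≤ 2∫|u(t)−u(T)|² + 2∫_B|u(T)|²`; the second term is small for small `r` by
absolute continuity, `tendsto_setLIntegral_zero` with `|B(x₀,r)| → 0`). The conclusion is the shape of
stub `stub_noEnergyAtom` of `Cruxes/WeakLambdaCriterion/Lines/birth.lean` (route WeakLambdaEndpoint,
crux stmt-NavierStokesRegularity-19625). [folklore] -/
theorem exists_ball_forall_eventually_lt_of_tendsto_eLpNorm_sub {T : ℝ}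
    {u : ℝ → EuclideanSpace ℝ (Fin 3) → EuclideanSpace ℝ (Fin 3)}
    (hmeas : ∀ᶠ t in 𝓝[<] T, AEStronglyMeasurable (u t) volume) (hT : MemLp (u T) 2 volume)
    (hconv : Tendsto (fun t => eLpNorm (u t - u T) 2 volume) (𝓝[<] T) (𝓝 0))
    (x₀ : EuclideanSpace ℝ (Fin 3)) {η : NNReal} (hη : 0 < η) :
    ∃ r : ℝ, 0 < r ∧ ∀ᶠ t in 𝓝[<] T, ∫⁻ x in Metric.ball x₀ r, ‖u t x‖ₑ ^ 2 < (η : ℝ≥0∞) := by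
  -- threshold `δ = (η/2)/2`
  set δ : ℝ≥0∞ := (η : ℝ≥0∞) / 2 / 2 with hδ
  have hη' : (η : ℝ≥0∞) ≠ 0 := by exact_mod_cast hη.ne'
  have hδ0 : 0 < δ := by
    rw [hδ]; exact ENNReal.div_pos (ENNReal.div_pos hη' (by norm_num)).ne' (by norm_num)
  -- (1) small balls carry little terminal energy
  have h2T : ∫⁻ x, ‖u T x‖ₑ ^ 2 ≠ ⊤ := by
    rw [lintegral_enorm_sq_eq_eLpNorm_two_sq]
    exact (ENNReal.pow_lt_top hT.eLpNorm_lt_top).ne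
  have hvol : Tendsto (fun r : ℝ => volume (Metric.ball x₀ r)) (𝓝[>] 0) (𝓝 0) := by
    have hball : ∀ r : ℝ, 0 < r → volume (Metric.ball x₀ r) =
        ENNReal.ofReal (r ^ 3) * volume (Metric.ball (0 : EuclideanSpace ℝ (Fin 3)) 1) := by
      intro r hr
      rw [Measure.addHaar_ball volume x₀ hr.le, finrank_euclideanSpace_fin]
    have h0 : Tendsto (fun r : ℝ => ENNReal.ofReal (r ^ 3) *
        volume (Metric.ball (0 : EuclideanSpace ℝ (Fin 3)) 1)) (𝓝[>] 0) (𝓝 0) := by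
      have h1 : Tendsto (fun r : ℝ => r ^ 3) (𝓝[>] (0 : ℝ)) (𝓝 0) := by
        have := ((continuous_pow 3).tendsto (0 : ℝ))
        rw [zero_pow (by norm_num)] at this
        exact tendsto_nhdsWithin_of_tendsto_nhds this
      have h2 : Tendsto (fun r : ℝ => ENNReal.ofReal (r ^ 3)) (𝓝[>] (0 : ℝ)) (𝓝 0) := by
        rw [← ENNReal.ofReal_zero]; exact ENNReal.tendsto_ofReal h1
      have h3 := ENNReal.Tendsto.mul_const h2
        (Or.inr (measure_ball_lt_top (μ := (volume : Measure (EuclideanSpace ℝ (Fin 3))))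
          (x := (0 : EuclideanSpace ℝ (Fin 3))) (r := 1)).ne)
      rwa [zero_mul] at h3
    refine h0.congr' ?_
    filter_upwards [self_mem_nhdsWithin] with r hr
    exact (hball r hr).symm
  have hsmall := tendsto_setLIntegral_zero (μ := volume) h2T hvol
  obtain ⟨r, hr, hrpos⟩ := ((hsmall.eventually (gt_mem_nhds hδ0)).and self_mem_nhdsWithin).exists
  refine ⟨r, hrpos, ?_⟩
  -- (2) the global `L²` distance is eventually small
  have hdist : Tendsto (fun t => ∫⁻ x, ‖u t x - u T x‖ₑ ^ 2) (𝓝[<] T) (𝓝 0) := by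
    have h := (ENNReal.continuous_pow 2).tendsto 0 |>.comp hconv
    rw [zero_pow two_ne_zero] at h
    refine h.congr fun t => ?_
    simp only [Function.comp]
    rw [lintegral_enorm_sq_eq_eLpNorm_two_sq]
    rfl
  filter_upwards [hdist.eventually (gt_mem_nhds hδ0), hmeas] with t ht hmt
  -- (3) combine
  have hTm : AEStronglyMeasurable (u T) volume := hT.aestronglyMeasurable
  have hpt : ∀ x, ‖u t x‖ₑ ^ 2 ≤ 2 * ‖u t x - u T x‖ₑ ^ 2 + 2 * ‖u T x‖ₑ ^ 2 := fun x =>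
    enorm_sq_le_two_mul_add _ _
  have hm1 : AEMeasurable (fun x => 2 * ‖u t x - u T x‖ₑ ^ 2) (volume.restrict (Metric.ball x₀ r)) :=
    (((hmt.sub hTm).enorm.pow_const 2).const_mul 2).restrict
  calc ∫⁻ x in Metric.ball x₀ r, ‖u t x‖ₑ ^ 2
      ≤ ∫⁻ x in Metric.ball x₀ r, (2 * ‖u t x - u T x‖ₑ ^ 2 + 2 * ‖u T x‖ₑ ^ 2) :=
        lintegral_mono fun x => hpt x
    _ = (2 * ∫⁻ x in Metric.ball x₀ r, ‖u t x - u T x‖ₑ ^ 2) +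
          2 * ∫⁻ x in Metric.ball x₀ r, ‖u T x‖ₑ ^ 2 := by
        rw [lintegral_add_left' hm1, lintegral_const_mul' _ _ (by norm_num),
          lintegral_const_mul' _ _ (by norm_num)]
    _ ≤ (2 * ∫⁻ x, ‖u t x - u T x‖ₑ ^ 2) + 2 * ∫⁻ x in Metric.ball x₀ r, ‖u T x‖ₑ ^ 2 := by
        gcongr
        exact Measure.restrict_le_self
    _ < 2 * δ + 2 * δ := by
        have hA : 2 * ∫⁻ x, ‖u t x - u T x‖ₑ ^ 2 < 2 * δ := by
          rw [mul_comm 2 (∫⁻ x, ‖u t x - u T x‖ₑ ^ 2), mul_comm 2 δ]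
          exact ENNReal.mul_lt_mul_left (by norm_num) (by norm_num) ht
        have hB : 2 * ∫⁻ x in Metric.ball x₀ r, ‖u T x‖ₑ ^ 2 < 2 * δ := by
          rw [mul_comm 2 (∫⁻ x in Metric.ball x₀ r, ‖u T x‖ₑ ^ 2), mul_comm 2 δ]
          exact ENNReal.mul_lt_mul_left (by norm_num) (by norm_num) hr
        exact ENNReal.add_lt_add hA hB
    _ = (η : ℝ≥0∞) := by
        rw [hδ, two_mul, ENNReal.add_halves, ENNReal.add_halves]

/-! ### In the frame: no energy atom at `T` under Type I, under a mild enstrophy rate, under stub 3 -/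

/-- **No energy jump ⇒ no energy atom, in the frame.** `(u,p)` classical on `[0,T)` (`T > 0`),
Leray–Hopf on `[0,T]`; if `‖u(t) − u(T)‖_{L²} → 0` as `t ↑ T` then `u` has no energy atom at `T`.
[folklore] -/
theorem noEnergyAtom_of_tendsto_eLpNorm_sub {ν T : ℝ} (hT : 0 < T)
    {u : ℝ → EuclideanSpace ℝ (Fin 3) → EuclideanSpace ℝ (Fin 3)} {p : ℝ → EuclideanSpace ℝ (Fin 3) → ℝ}
    (hcl : IsClassicalNSSolutionOn (Ico 0 T) ν 0 u p) (hLH : IsLerayHopfOn T ν 0 (u 0) u)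
    (hconv : Tendsto (fun t => eLpNorm (u t - u T) 2 volume) (𝓝[<] T) (𝓝 0))
    (x₀ : EuclideanSpace ℝ (Fin 3)) {η : NNReal} (hη : 0 < η) :
    ∃ r : ℝ, 0 < r ∧ ∀ᶠ t in 𝓝[<] T, ∫⁻ x in Metric.ball x₀ r, ‖u t x‖ₑ ^ 2 < (η : ℝ≥0∞) := by
  have hmeas : ∀ᶠ t in 𝓝[<] T, AEStronglyMeasurable (u t) volume := by
    filter_upwards [Ioo_mem_nhdsLT hT] with t ht
    exact (hcl.contDiff_velocity ⟨ht.1.le, ht.2⟩).continuous.aestronglyMeasurable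
  exact exists_ball_forall_eventually_lt_of_tendsto_eLpNorm_sub hmeas (hLH.memLp T ⟨hT.le, le_rfl⟩)
    hconv x₀ hη

/-- **A Type-I blow-up leaves no energy atom** (Leslie–Shvydkoy 2018, Thm. 1.2 / §1.3, in the frame):
`(u,p)` classical on `[0,T)`, Leray–Hopf on `[0,T]` from a rapidly decaying datum, with the Type-I rate
at `T`; then for every `x₀`, `η > 0` there is `r > 0` with `∫_{B(x₀,r)}‖u(t)‖² < η` for `t < T` near
`T` — the Type-I case of stub `stub_noEnergyAtom` of `Cruxes/WeakLambdaCriterion/Lines/birth.lean`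
(crux stmt-19625, route WeakLambdaEndpoint; its docstring: «Known under Type I in time»), now a tree
theorem via `tendsto_eLpNorm_sub_of_isTypeIBlowup` (p639359). [folklore] -/
theorem noEnergyAtom_of_isTypeIBlowup {ν T : ℝ} (hν : 0 < ν) (hT : 0 < T)
    {u : ℝ → EuclideanSpace ℝ (Fin 3) → EuclideanSpace ℝ (Fin 3)} {p : ℝ → EuclideanSpace ℝ (Fin 3) → ℝ}
    (hcl : IsClassicalNSSolutionOn (Ico 0 T) ν 0 u p) (hLH : IsLerayHopfOn T ν 0 (u 0) u)
    (hdec : HasRapidSpatialDecay (u 0)) (hTI : IsTypeIBlowup u T)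
    (x₀ : EuclideanSpace ℝ (Fin 3)) {η : NNReal} (hη : 0 < η) :
    ∃ r : ℝ, 0 < r ∧ ∀ᶠ t in 𝓝[<] T, ∫⁻ x in Metric.ball x₀ r, ‖u t x‖ₑ ^ 2 < (η : ℝ≥0∞) :=
  noEnergyAtom_of_tendsto_eLpNorm_sub hT hcl hLH
    (tendsto_eLpNorm_sub_of_isTypeIBlowup hν hT hcl hLH hdec hTI) x₀ hη

/-- **A first blow-up with enstrophy below `(T−t)^{−4/5}` leaves no energy atom** (via
`tendsto_eLpNorm_sub_of_enstrophyRate`, p641804). [folklore] -/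
theorem noEnergyAtom_of_enstrophyRate {ν T : ℝ} (hν : 0 < ν) (hT : 0 < T)
    {u : ℝ → EuclideanSpace ℝ (Fin 3) → EuclideanSpace ℝ (Fin 3)} {p : ℝ → EuclideanSpace ℝ (Fin 3) → ℝ}
    (hcl : IsClassicalNSSolutionOn (Ico 0 T) ν 0 u p) (hLH : IsLerayHopfOn T ν 0 (u 0) u)
    (hdec : HasRapidSpatialDecay (u 0))
    {M α : ℝ} (hM : 0 ≤ M) (hα0 : 0 < α) (hα : α < 4 / 5)
    (hrate : ∀ᶠ t in 𝓝[<] T, ∫ x, frobeniusNormSq (fderiv ℝ (u t) x) ≤ M * (T - t) ^ (-α))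
    (x₀ : EuclideanSpace ℝ (Fin 3)) {η : NNReal} (hη : 0 < η) :
    ∃ r : ℝ, 0 < r ∧ ∀ᶠ t in 𝓝[<] T, ∫⁻ x in Metric.ball x₀ r, ‖u t x‖ₑ ^ 2 < (η : ℝ≥0∞) :=
  noEnergyAtom_of_tendsto_eLpNorm_sub hT hcl hLH
    (tendsto_eLpNorm_sub_of_enstrophyRate hν hT hcl hLH hdec hM hα0 hα hrate) x₀ hη

/-- **«No energy jump at any first blow-up» ⇒ «no energy atom at any frame time»** — a typed edge
from (the hypothesis-free form of) stub `stub_typeIIEnergyEquality` of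
`Cruxes/NoTerminalJolt/Lines/regular_split.lean` (crux stmt-26463) to the statement of stub
`stub_noEnergyAtom` of `Cruxes/WeakLambdaCriterion/Lines/birth.lean` (crux stmt-19625) VERBATIM. At a
regular time the energy is continuous (`noTerminalJolt_of_hasSmoothExtensionPast`, p619494, with the
energy-jump law); at a first blow-up time the hypothesis applies. Both statements are OPEN; nothing is
asserted about them. [folklore] -/
theorem noEnergyAtom_of_energyEqualityAtBlowup
    (h : ∀ (ν T : ℝ), 0 < ν → 0 < T →
      ∀ (u : ℝ → EuclideanSpace ℝ (Fin 3) → EuclideanSpace ℝ (Fin 3))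
        (p : ℝ → EuclideanSpace ℝ (Fin 3) → ℝ),
        Literature.Analysis.FluidPDE.IsMaximalSmoothSolution ν 0 u p T →
        Literature.Analysis.FluidPDE.IsLerayHopfOn T ν 0 (u 0) u →
        Literature.Analysis.FluidPDE.HasRapidSpatialDecay (u 0) →
        Filter.Tendsto (fun t => MeasureTheory.eLpNorm (u t - u T) 2 MeasureTheory.volume)
          (nhdsWithin T (Set.Iio T)) (nhds 0)) :
    ∀ (ν T : ℝ), 0 < ν → 0 < T →
      ∀ (u : ℝ → EuclideanSpace ℝ (Fin 3) → EuclideanSpace ℝ (Fin 3))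
        (p : ℝ → EuclideanSpace ℝ (Fin 3) → ℝ),
        Literature.Analysis.FluidPDE.IsClassicalNSSolutionOn (Set.Ico 0 T) ν 0 u p →
        Literature.Analysis.FluidPDE.IsLerayHopfOn T ν 0 (u 0) u →
        Literature.Analysis.FluidPDE.HasRapidSpatialDecay (u 0) →
        ∀ (x₀ : EuclideanSpace ℝ (Fin 3)) (η : NNReal), 0 < η →
          ∃ r : ℝ, 0 < r ∧ ∀ᶠ t in 𝓝[<] T,
            ∫⁻ x in Metric.ball x₀ r, ‖u t x‖ₑ ^ 2 < (η : ENNReal) := by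
  intro ν T hν hT u p hcl hLH hdec x₀ η hη
  refine noEnergyAtom_of_tendsto_eLpNorm_sub hT hcl hLH ?_ x₀ hη
  by_cases hext : HasSmoothExtensionPast ν 0 u T
  · exact tendsto_eLpNorm_sub_of_tendsto_joltFunctional hT hLH
      (noTerminalJolt_of_hasSmoothExtensionPast hν hT hcl hLH hdec hext)
  · exact h ν T hν hT u p ⟨hcl, hext⟩ hLH hdec

/-- **Stub 3 of `regular_split` ⇒ stub 2 of WeakLambdaCriterion's `birth`** (crux stmt-26463's
`stub_typeIIEnergyEquality` statement — non-Type-I first blow-ups have no energy jump — implies crux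
stmt-19625's `stub_noEnergyAtom` statement, both VERBATIM; the Type-I case is the theorem
`tendsto_eLpNorm_sub_of_isTypeIBlowup`, `typeIIEnergyEquality_iff_energyEqualityAtBlowup`, p639589).
A typed edge between two registered OPEN stubs of different routes; nothing is asserted about either.
[folklore] -/
theorem noEnergyAtom_of_typeIIEnergyEquality
    (h : ∀ (ν T : ℝ), 0 < ν → 0 < T →
      ∀ (u : ℝ → EuclideanSpace ℝ (Fin 3) → EuclideanSpace ℝ (Fin 3))
        (p : ℝ → EuclideanSpace ℝ (Fin 3) → ℝ),
        Literature.Analysis.FluidPDE.IsMaximalSmoothSolution ν 0 u p T →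
        Literature.Analysis.FluidPDE.IsLerayHopfOn T ν 0 (u 0) u →
        Literature.Analysis.FluidPDE.HasRapidSpatialDecay (u 0) →
        ¬ Literature.Analysis.FluidPDE.IsTypeIBlowup u T →
        Filter.Tendsto (fun t => MeasureTheory.eLpNorm (u t - u T) 2 MeasureTheory.volume)
          (nhdsWithin T (Set.Iio T)) (nhds 0)) :
    ∀ (ν T : ℝ), 0 < ν → 0 < T →
      ∀ (u : ℝ → EuclideanSpace ℝ (Fin 3) → EuclideanSpace ℝ (Fin 3))
        (p : ℝ → EuclideanSpace ℝ (Fin 3) → ℝ),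
        Literature.Analysis.FluidPDE.IsClassicalNSSolutionOn (Set.Ico 0 T) ν 0 u p →
        Literature.Analysis.FluidPDE.IsLerayHopfOn T ν 0 (u 0) u →
        Literature.Analysis.FluidPDE.HasRapidSpatialDecay (u 0) →
        ∀ (x₀ : EuclideanSpace ℝ (Fin 3)) (η : NNReal), 0 < η →
          ∃ r : ℝ, 0 < r ∧ ∀ᶠ t in 𝓝[<] T,
            ∫⁻ x in Metric.ball x₀ r, ‖u t x‖ₑ ^ 2 < (η : ENNReal) :=
  noEnergyAtom_of_energyEqualityAtBlowup (typeIIEnergyEquality_iff_energyEqualityAtBlowup.1 h)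

/-- **`NoTerminalJolt ⇒` no energy atom at any frame time** (crux stmt-26463 BY NAME ⇒ the statement of
WeakLambdaCriterion's stub `stub_noEnergyAtom`, crux stmt-19625, VERBATIM): a typed edge between two
routes; the crux is OPEN, nothing is asserted about it. [folklore] -/
theorem noEnergyAtom_of_noTerminalJolt (h : Theses.QuarterJolt.NoTerminalJolt) :
    ∀ (ν T : ℝ), 0 < ν → 0 < T →
      ∀ (u : ℝ → EuclideanSpace ℝ (Fin 3) → EuclideanSpace ℝ (Fin 3))
        (p : ℝ → EuclideanSpace ℝ (Fin 3) → ℝ),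
        Literature.Analysis.FluidPDE.IsClassicalNSSolutionOn (Set.Ico 0 T) ν 0 u p →
        Literature.Analysis.FluidPDE.IsLerayHopfOn T ν 0 (u 0) u →
        Literature.Analysis.FluidPDE.HasRapidSpatialDecay (u 0) →
        ∀ (x₀ : EuclideanSpace ℝ (Fin 3)) (η : NNReal), 0 < η →
          ∃ r : ℝ, 0 < r ∧ ∀ᶠ t in 𝓝[<] T,
            ∫⁻ x in Metric.ball x₀ r, ‖u t x‖ₑ ^ 2 < (η : ENNReal) :=
  fun ν T hν hT u p hcl hLH hdec x₀ _ hη =>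
    noEnergyAtom_of_tendsto_eLpNorm_sub hT hcl hLH
      (tendsto_eLpNorm_sub_of_tendsto_joltFunctional hT hLH (h ν T hν hT u p hcl hLH hdec)) x₀ hη

end NoTerminalJolt

end Summit.NavierStokesRegularity.NavierStokesRegularity.Theorems

end
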